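import Mathlib
import Summits.NavierStokesRegularity.FluidComputer.SkewCutGalerkinInjectivity

/-!
# Skew-cut certificate: the tail Schur form in resolvent coordinates (SKEWCUT-CERT §3 STEP 1–2,
diagonal / Hilbert-basis setting)
(instab4 g4 — implementation 2 of the skew-cut X0 certifier, cell `ns-blowup`, 2026-08-26)

HONEST FRAMING (human ruling D-0035): nothing here is a claim about Navier–Stokes blow-up.
WHAT THIS IS NOT: not NS evidence. MODEL lane. Companion of `SkewCutGalerkinInjectivity.lean`
(p443431), whose hypothesis «the Schur form is coercive on the tail against `S₀`»,

  `μ ‖S₀ w‖² ≤ Re ⟪R_a w − R_a (Ainv (P (R_a w))), S₀ w⟫`  (`w ∈ Uᗮ`, `R_a = 1 − T − (x₀ − a) S₀`),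

is here SPLIT into the three named pieces of the method note (§3, proof of Thm 1/1′, STEP 1–2) when
`S₀ = diag(d)` is the diagonal free resolvent in a Hilbert basis `b` (`d_i (x₀ − ℓ_i) = 1`) preserving
the truncation `U` and its orthogonal complement, and `Ainv` is linear with values in `U`:

* `schur_pairing_eq`: `⟪R_a w − R_a(Ainv(P(R_a w))), S₀ w⟫ = ⟪w − (x₀ − a) S₀ w, S₀ w⟫ − ⟪T w, S₀ w⟫
   − ⟪T (Ainv (P (T w))), S₀ w⟫` — DIAGONAL part, PAIRING with the first-order part
  (`= ⟨A v, v⟩`, `v = S₀ w`, `A v = T w`), and the CROSS TERM through the head (`= ⟨C A⁻¹ B v, v⟩`);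
* `hasSum_diagonal_pairing`: `Re ⟪w − (x₀ − a) S₀ w, S₀ w⟫ = Σ_i (a − ℓ_i) |⟪b i, S₀ w⟫|²`
  (`= x‖v‖² + ν‖∇v‖²` of STEP 1 for `ℓ = −ν|k|²`, `a = x`);
* `tail_coercive_of_structure`: if the pairing obeys the strain-type bound `Re ⟪T w, S₀ w⟫ ≤ s ‖S₀ w‖²`
  on the tail (the note's (F1) skewness + (F2) `⟨Sv, v⟩ ≥ −s‖v‖²`, Lemma S, `s = √2` — MODEL input),
  the certified SHELL inequality `MU2 Σ_{i ∈ sh} |v_i|² ≤ Σ_{i ∈ sh} (a − ℓ_i − s)|v_i|² − Re(cross)`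
  (= `λ_min(Λ_{K+1} − s + Q_K) ≥ MU2`, the certifier's (V5) test, with locality (F3): the cross term
  only sees shell `K+1`) and the TAIL CONSTANT `MU2 ≤ a − ℓ_i − s` beyond the shell, then the Schur
  form is coercive with `μ = MU2` — exactly the hypothesis `hcoer` of
  `SkewCutGalerkinInjectivity.injective_of_head_tail_coercive`; `not_eigenvalue_of_structure`
  composes the two.

What stays model-specific after this file: the strain-type bound (F1)+(F2) for the true `A`, locality
(F3) in the form «`Re(cross)` depends only on the shell coefficients» (used by the consumer to derive
the shell inequality from the certified matrix), and the numbers `MU2`, `a − ℓ_i − s`.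

Mathlib + `SkewCutGalerkinInjectivity`; no new definitions.
-/

noncomputable section

namespace Summit.NavierStokesRegularity.FluidComputer.SkewCutGalerkinTailForm

open Submodule
open scoped InnerProductSpace ComplexConjugate

variable {𝕜 H : Type*} [RCLike 𝕜] [NormedAddCommGroup H] [InnerProductSpace 𝕜 H]
variable {ι : Type*}

/-! ### The Schur pairing split into diagonal part, pairing and cross term -/

/-- **STEP 2 bookkeeping.** For `w ∈ Uᗮ` with `S₀ w ∈ Uᗮ`, `S₀ (U) ⊆ U`, `Ainv` linear with values
in `U` on `U`: `⟪R_a w − R_a (Ainv (P (R_a w))), S₀ w⟫ = ⟪w − (x₀−a) S₀ w, S₀ w⟫ − ⟪T w, S₀ w⟫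
− ⟪T (Ainv (P (T w))), S₀ w⟫`, `R_a = 1 − T − (x₀ − a) S₀`, `P` the star projection onto `U`. -/
theorem schur_pairing_eq (S₀ T : H →L[𝕜] H) (x₀ a : 𝕜) (U : Submodule 𝕜 H)
    [U.HasOrthogonalProjection] (hS₀U : ∀ z ∈ U, S₀ z ∈ U) (Ainv : H →ₗ[𝕜] H)
    (hAinvU : ∀ y ∈ U, Ainv y ∈ U) {w : H} (hw : w ∈ Uᗮ) (hSw : S₀ w ∈ Uᗮ) :
    ⟪((1 : H →L[𝕜] H) - T - (x₀ - a) • S₀) w -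
        ((1 : H →L[𝕜] H) - T - (x₀ - a) • S₀)
          (Ainv (U.starProjection (((1 : H →L[𝕜] H) - T - (x₀ - a) • S₀) w))), S₀ w⟫_𝕜 =
      ⟪w - (x₀ - a) • S₀ w, S₀ w⟫_𝕜 - ⟪T w, S₀ w⟫_𝕜 -
        ⟪T (Ainv (U.starProjection (T w))), S₀ w⟫_𝕜 := by
  set P := U.starProjection with hP
  have hPw : P w = 0 := (starProjection_apply_eq_zero_iff U).2 hw
  have hPSw : P (S₀ w) = 0 := (starProjection_apply_eq_zero_iff U).2 hSw
  -- `P (R_a w) = - P (T w)`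
  have hR : ((1 : H →L[𝕜] H) - T - (x₀ - a) • S₀) w = w - T w - (x₀ - a) • S₀ w := by
    simp only [sub_apply, FunLike.coe_smul, Pi.smul_apply, one_apply_eq_self]
  have hPR : P (((1 : H →L[𝕜] H) - T - (x₀ - a) • S₀) w) = -P (T w) := by
    rw [hR, map_sub, map_sub, map_smul, hPw, hPSw, smul_zero, sub_zero, zero_sub]
  -- the head vector `h := Ainv (P (T w)) ∈ U` pairs trivially with `S₀ w ∈ Uᗮ`
  set h : H := Ainv (P (T w)) with hh
  have hhU : h ∈ U := hAinvU _ (U.starProjection_apply_mem _)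
  have h0 : ⟪h, S₀ w⟫_𝕜 = 0 := inner_right_of_mem_orthogonal hhU hSw
  have h0' : ⟪S₀ h, S₀ w⟫_𝕜 = 0 := inner_right_of_mem_orthogonal (hS₀U h hhU) hSw
  have hRh : ((1 : H →L[𝕜] H) - T - (x₀ - a) • S₀) (Ainv (P (((1 : H →L[𝕜] H) - T -
      (x₀ - a) • S₀) w))) = -(h - T h - (x₀ - a) • S₀ h) := by
    rw [hPR, map_neg, map_neg, ← hh]
    simp only [sub_apply, FunLike.coe_smul, Pi.smul_apply, one_apply_eq_self]
  rw [hRh, hR]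
  simp only [sub_neg_eq_add, inner_add_left, inner_sub_left, inner_smul_left, h0, h0', mul_zero,
    sub_zero, zero_sub]
  ring

/-! ### The diagonal part in coordinates -/

/-- **STEP 1 in coordinates.** For the diagonal free resolvent `S₀ = diag(d)` with
`d_i (x₀ − ℓ_i) = 1`: `Re ⟪w − (x₀ − a) S₀ w, S₀ w⟫ = Σ_i (a − ℓ_i) |⟪b i, S₀ w⟫|²` (as a `HasSum`;
for `ℓ_i = −ν|k_i|²` this is `a‖v‖² + ν‖∇v‖²`, `v = S₀ w`). -/
theorem hasSum_diagonal_pairing [CompleteSpace H] (b : HilbertBasis ι 𝕜 H) (ℓ : ι → ℝ) (x₀ a : ℝ)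
    (d : lp (fun _ : ι => 𝕜) ⊤) (hd : ∀ i, d i * ((x₀ : 𝕜) - (ℓ i : 𝕜)) = 1) (w : H) :
    HasSum (fun i => (a - ℓ i) * ‖⟪b i, b.diagonalCLM d w⟫_𝕜‖ ^ 2)
      (RCLike.re ⟪w - ((x₀ : 𝕜) - (a : 𝕜)) • b.diagonalCLM d w, b.diagonalCLM d w⟫_𝕜) := by
  set v : H := b.diagonalCLM d w with hv
  -- coordinates: `v_i = d_i w_i`, hence `w_i = (x₀ - ℓ_i) v_i`
  have hvi : ∀ i, ⟪b i, v⟫_𝕜 = d i * ⟪b i, w⟫_𝕜 := fun i => by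
    rw [← b.repr_apply_apply, ← b.repr_apply_apply, hv, b.diagonalCLM_apply_repr]
  have hwi : ∀ i, ⟪b i, w⟫_𝕜 = ((x₀ : 𝕜) - (ℓ i : 𝕜)) * ⟪b i, v⟫_𝕜 := fun i => by
    rw [hvi, ← mul_assoc, mul_comm ((x₀ : 𝕜) - (ℓ i : 𝕜)), hd, one_mul]
  -- `⟪b i, w - (x₀ - a) v⟫ = (a - ℓ_i) v_i`
  have hxi : ∀ i, ⟪b i, w - ((x₀ : 𝕜) - (a : 𝕜)) • v⟫_𝕜 = ((a - ℓ i : ℝ) : 𝕜) * ⟪b i, v⟫_𝕜 := by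
    intro i
    rw [inner_sub_right, inner_smul_right, hwi i]
    push_cast
    ring
  -- `Re (conj (c z) z) = c |z|²` for real `c`
  have key : ∀ (c : ℝ) (z : 𝕜), RCLike.re ((starRingEnd 𝕜) ((c : 𝕜) * z) * z) = c * ‖z‖ ^ 2 := by
    intro c z
    rw [map_mul (starRingEnd 𝕜), RCLike.conj_ofReal, mul_assoc, RCLike.conj_mul,
      ← RCLike.ofReal_pow, ← RCLike.ofReal_mul, RCLike.ofReal_re]
  -- Parseval against `v`, then real parts
  set x' : H := w - ((x₀ : 𝕜) - (a : 𝕜)) • v with hx'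
  have hP := b.hasSum_inner_mul_inner x' v
  have hre := RCLike.hasSum_re _ hP
  refine hre.congr_fun fun i => ?_
  have hci : ⟪x', b i⟫_𝕜 = (starRingEnd 𝕜) ⟪b i, x'⟫_𝕜 := (inner_conj_symm _ _).symm
  rw [hci, hxi i, key]

/-! ### Coercivity of the Schur form from the structure (F1)–(F3) and the certified numbers -/

/-- **STEP 1–2 ⇒ coercivity.** Tail vector `w ∈ Uᗮ` (so `v := S₀ w ∈ Uᗮ`, `v_i = 0` on the head);
PAIRING bound `Re ⟪T w, v⟫ ≤ s ‖v‖²` (strain-type, (F1)+(F2)); SHELL inequality on a finite index set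
`sh` (the certified `λ_min(Λ_{K+1} − s + Q_K) ≥ MU2`, cross term included);
TAIL CONSTANT `MU2 ≤ a − ℓ_i − s` off the head and the shell. Then
`MU2 ‖v‖² ≤ Re ⟪R_a w − R_a (Ainv (P (R_a w))), v⟫`. -/
theorem tail_coercive_of_structure [CompleteSpace H] (b : HilbertBasis ι 𝕜 H) (ℓ : ι → ℝ)
    (x₀ a : ℝ) (d : lp (fun _ : ι => 𝕜) ⊤) (hd : ∀ i, d i * ((x₀ : 𝕜) - (ℓ i : 𝕜)) = 1)
    (T : H →L[𝕜] H) (U : Submodule 𝕜 H) [U.HasOrthogonalProjection]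
    (hS₀U : ∀ z ∈ U, b.diagonalCLM d z ∈ U) (Ainv : H →ₗ[𝕜] H) (hAinvU : ∀ y ∈ U, Ainv y ∈ U)
    {w : H} (hw : w ∈ Uᗮ) (hSw : b.diagonalCLM d w ∈ Uᗮ)
    (hhead : ∀ i, b i ∈ U ∨ b i ∈ Uᗮ)
    {s MU2 : ℝ} (sh : Finset ι)
    (hpair : RCLike.re ⟪T w, b.diagonalCLM d w⟫_𝕜 ≤ s * ‖b.diagonalCLM d w‖ ^ 2)
    (hshell : MU2 * ∑ i ∈ sh, ‖⟪b i, b.diagonalCLM d w⟫_𝕜‖ ^ 2 ≤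
      ∑ i ∈ sh, (a - ℓ i - s) * ‖⟪b i, b.diagonalCLM d w⟫_𝕜‖ ^ 2 -
        RCLike.re ⟪T (Ainv (U.starProjection (T w))), b.diagonalCLM d w⟫_𝕜)
    (htail : ∀ i, b i ∉ U → i ∉ sh → MU2 ≤ a - ℓ i - s) :
    MU2 * ‖b.diagonalCLM d w‖ ^ 2 ≤
      RCLike.re ⟪((1 : H →L[𝕜] H) - T - ((x₀ : 𝕜) - (a : 𝕜)) • b.diagonalCLM d) w -
        ((1 : H →L[𝕜] H) - T - ((x₀ : 𝕜) - (a : 𝕜)) • b.diagonalCLM d)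
          (Ainv (U.starProjection (((1 : H →L[𝕜] H) - T - ((x₀ : 𝕜) - (a : 𝕜)) •
            b.diagonalCLM d) w))), b.diagonalCLM d w⟫_𝕜 := by
  set S₀ : H →L[𝕜] H := b.diagonalCLM d with hS₀
  set v : H := S₀ w with hv
  set c : ι → ℝ := fun i => ‖⟪b i, v⟫_𝕜‖ ^ 2 with hc
  have hc0 : ∀ i, 0 ≤ c i := fun i => sq_nonneg _
  -- head coefficients of `v ∈ Uᗮ` vanish
  have hchead : ∀ i, b i ∈ U → c i = 0 := fun i hi => by
    simp only [hc]
    rw [inner_right_of_mem_orthogonal hi hSw, norm_zero]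
    norm_num
  -- Parseval for `‖v‖²` and the diagonal identity
  have hnorm : HasSum c (‖v‖ ^ 2) := by
    have h := b.hasSum_inner_mul_inner v v
    have hre := RCLike.hasSum_re _ h
    rw [← InnerProductSpace.norm_sq_eq_re_inner (𝕜 := 𝕜)] at hre
    refine hre.congr_fun fun i => ?_
    simp only [hc]
    have hci : ⟪v, b i⟫_𝕜 = (starRingEnd 𝕜) ⟪b i, v⟫_𝕜 := (inner_conj_symm _ _).symm
    rw [hci, RCLike.conj_mul, ← RCLike.ofReal_pow, RCLike.ofReal_re]
  have hdiag := hasSum_diagonal_pairing b ℓ x₀ a d hd w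
  -- the pairing split
  rw [schur_pairing_eq S₀ T (x₀ : 𝕜) (a : 𝕜) U hS₀U Ainv hAinvU hw hSw, map_sub, map_sub]
  set cross : ℝ := RCLike.re ⟪T (Ainv (U.starProjection (T w))), v⟫_𝕜 with hcross
  -- `Re ⟪w - (x₀-a) v, v⟫ - Re ⟪T w, v⟫ ≥ Σ (a - ℓ_i - s) c_i`
  have hsum1 : HasSum (fun i => (a - ℓ i - s) * c i)
      (RCLike.re ⟪w - ((x₀ : 𝕜) - (a : 𝕜)) • v, v⟫_𝕜 - s * ‖v‖ ^ 2) := by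
    have := hdiag.sub (hnorm.mul_left s)
    refine this.congr_fun fun i => ?_
    simp only [hc]; ring
  have hstep1 : RCLike.re ⟪w - ((x₀ : 𝕜) - (a : 𝕜)) • v, v⟫_𝕜 - s * ‖v‖ ^ 2 - cross ≤
      RCLike.re ⟪w - ((x₀ : 𝕜) - (a : 𝕜)) • v, v⟫_𝕜 - RCLike.re ⟪T w, v⟫_𝕜 - cross := by
    linarith [hpair]
  -- split `Σ_i (a - ℓ_i - s) c_i` and `Σ_i c_i` into the shell `sh` and its complement
  have hsplit1 := hsum1.summable.sum_add_tsum_compl (s := sh)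
  have hsplit2 := hnorm.summable.sum_add_tsum_compl (s := sh)
  rw [hsum1.tsum_eq] at hsplit1
  rw [hnorm.tsum_eq] at hsplit2
  -- on the complement, termwise `MU2 c_i ≤ (a - ℓ_i - s) c_i` (head terms are `0 = 0`)
  have hcompl : MU2 * ∑' i : ↑((sh : Set ι)ᶜ), c i ≤ ∑' i : ↑((sh : Set ι)ᶜ), (a - ℓ i - s) * c i := by
    rw [← tsum_mul_left]
    refine Summable.tsum_le_tsum (fun i => ?_) ((hnorm.summable.subtype _).mul_left MU2)
      (hsum1.summable.subtype _)
    obtain ⟨i, hi⟩ := i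
    have hi' : i ∉ sh := by simpa using hi
    rcases hhead i with hU | hU
    · simp [hchead i hU]
    · have hnot : b i ∉ U := fun hbU => by
        have := inner_left_of_mem_orthogonal hbU hU
        rw [inner_self_eq_zero] at this
        exact (b.orthonormal.ne_zero i) this
      exact mul_le_mul_of_nonneg_right (htail i hnot hi') (hc0 i)
  -- assemble
  have hshell' : MU2 * ∑ i ∈ sh, c i ≤ ∑ i ∈ sh, (a - ℓ i - s) * c i - cross := hshell
  calc MU2 * ‖v‖ ^ 2 = MU2 * ∑ i ∈ sh, c i + MU2 * ∑' i : ↑((sh : Set ι)ᶜ), c i := by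
        rw [← mul_add, hsplit2]
    _ ≤ (∑ i ∈ sh, (a - ℓ i - s) * c i - cross) + ∑' i : ↑((sh : Set ι)ᶜ), (a - ℓ i - s) * c i :=
        add_le_add hshell' hcompl
    _ = RCLike.re ⟪w - ((x₀ : 𝕜) - (a : 𝕜)) • v, v⟫_𝕜 - s * ‖v‖ ^ 2 - cross := by
        rw [← hsplit1]; ring
    _ ≤ RCLike.re ⟪w - ((x₀ : 𝕜) - (a : 𝕜)) • v, v⟫_𝕜 - RCLike.re ⟪T w, v⟫_𝕜 - cross := hstep1

/-! ### Assembly: structure + certified numbers ⇒ the bracket end is not an eigenvalue -/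

/-- The diagonal free resolvent is injective (`d_i ≠ 0` because `d_i (x₀ − ℓ_i) = 1`). -/
theorem diagonalCLM_injective_of_resolvent (b : HilbertBasis ι 𝕜 H) (ℓ : ι → ℝ) (x₀ : ℝ)
    (d : lp (fun _ : ι => 𝕜) ⊤) (hd : ∀ i, d i * ((x₀ : 𝕜) - (ℓ i : 𝕜)) = 1) (w : H)
    (hw : b.diagonalCLM d w = 0) : w = 0 := by
  have hdi : ∀ i, d i ≠ 0 := fun i h => by
    have := hd i; rw [h, zero_mul] at this; exact zero_ne_one this
  apply b.repr.injective
  rw [map_zero]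
  ext i
  have h := congrArg (fun z => b.repr z i) hw
  simp only [b.diagonalCLM_apply_repr, map_zero, lp.coeFn_zero, Pi.zero_apply, mul_eq_zero] at h
  rcases h with h | h
  · exact absurd h (hdi i)
  · simpa using h

/-- **Theorem 1′ (a) at a bracket end from the structure and the certified numbers** (diagonal /
Hilbert-basis setting): head compression of `R_a` injective with a right inverse on the truncation `U`
(certified `det A⁽ᴷ⁾(a) ≠ 0`), `S₀ = diag(d)` preserving `U` and `Uᗮ`, every basis vector in `U` or in
`Uᗮ`, the strain-type PAIRING bound on the tail, the certified SHELL inequality with constant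
`MU2 > 0` and the TAIL CONSTANT beyond the shell ⇒ `a` is not an eigenvalue of `L₀ + A`
(the hypothesis shape of `SkewCutGalerkinPerturbation.exists_eigenpair_of_galerkin_brackets`). -/
theorem not_eigenvalue_of_structure [CompleteSpace H] (b : HilbertBasis ι 𝕜 H) (ℓ : ι → ℝ)
    (x₀ a : ℝ) (d : lp (fun _ : ι => 𝕜) ⊤) (hd : ∀ i, d i * ((x₀ : 𝕜) - (ℓ i : 𝕜)) = 1)
    (T : H →L[𝕜] H) (U : Submodule 𝕜 H) [U.HasOrthogonalProjection]
    (hS₀U : ∀ z ∈ U, b.diagonalCLM d z ∈ U) (hS₀U' : ∀ z ∈ Uᗮ, b.diagonalCLM d z ∈ Uᗮ)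
    (hhead : ∀ i, b i ∈ U ∨ b i ∈ Uᗮ) (Ainv : H →ₗ[𝕜] H) (hAinvU : ∀ y ∈ U, Ainv y ∈ U)
    (hAinv : ∀ y ∈ U, U.starProjection (((1 : H →L[𝕜] H) - T -
      ((x₀ : 𝕜) - (a : 𝕜)) • b.diagonalCLM d) (Ainv y)) = y)
    (hAinj : ∀ u ∈ U, U.starProjection (((1 : H →L[𝕜] H) - T -
      ((x₀ : 𝕜) - (a : 𝕜)) • b.diagonalCLM d) u) = 0 → u = 0)
    {s MU2 : ℝ} (hMU2 : 0 < MU2) (sh : Finset ι)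
    (hpair : ∀ w ∈ Uᗮ, RCLike.re ⟪T w, b.diagonalCLM d w⟫_𝕜 ≤ s * ‖b.diagonalCLM d w‖ ^ 2)
    (hshell : ∀ w ∈ Uᗮ, MU2 * ∑ i ∈ sh, ‖⟪b i, b.diagonalCLM d w⟫_𝕜‖ ^ 2 ≤
      ∑ i ∈ sh, (a - ℓ i - s) * ‖⟪b i, b.diagonalCLM d w⟫_𝕜‖ ^ 2 -
        RCLike.re ⟪T (Ainv (U.starProjection (T w))), b.diagonalCLM d w⟫_𝕜)
    (htail : ∀ i, b i ∉ U → i ∉ sh → MU2 ≤ a - ℓ i - s) :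
    ∀ w : H, (x₀ : 𝕜) • b.diagonalCLM d w - w + T w = (a : 𝕜) • b.diagonalCLM d w →
      b.diagonalCLM d w = 0 :=
  SkewCutGalerkinInjectivity.not_eigenvalue_of_head_tail_coercive (b.diagonalCLM d) T
    (diagonalCLM_injective_of_resolvent b ℓ x₀ d hd) (x₀ : 𝕜) (a : 𝕜) U Ainv hAinvU hAinv hAinj hMU2
    (fun w hw => tail_coercive_of_structure b ℓ x₀ a d hd T U hS₀U Ainv hAinvU hw (hS₀U' w hw)
      hhead sh (hpair w hw) (hshell w hw) htail)

end Summit.NavierStokesRegularity.FluidComputer.SkewCutGalerkinTailForm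

end
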